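import Literature.Probability.RandomPlanarGeometry.CardyFunctionIncBeta
import Literature.Probability.RandomPlanarGeometry.GaussIncompleteBeta
import Mathlib.Analysis.Calculus.ParametricIntegral
import Mathlib.MeasureTheory.Function.JacobianOneDim
import HarnessLib

/-!
# The Euler-transformation identity behind the uniform hitting law in the equilateral triangle

Special-function layer of the proof of
`Literature.Probability.RandomPlanarGeometry.LawlerSchrammWerner2001_orbm_uniformHitting`
(`ObliqueRBMWedge.lean`). With the Euler integral

  `N(η) = ∫₀¹ s^{-1/3} (1-s)^{-1/3} (1 - η s)^{-1} ds = B(2/3,2/3) ₂F₁(1, 2/3; 4/3; η)`, `η < 1`,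

we prove

* `eulerThird_ode` — the first-order equation `η(1-η) N'(η) + ((1-2η)/3) N(η) = N(0)/3`
  (an integration by parts: `∫₀¹ (d/ds)[s^{2/3}(1-s)^{2/3}/(1-ηs)] ds = 0`);
* `rpow_mul_eulerThird_eq` — its integrated form
  `η^{1/3} (1-η)^{1/3} N(η) = (N(0)/3) · B(η; 1/3, 1/3)` on `(0, 1)`
  (`Literature.Probability.RandomPlanarGeometry.incBeta13`), i.e. Euler's transformation
  `₂F₁(1, 2/3; 4/3; η) = (1-η)^{-1/3} ₂F₁(1/3, 2/3; 4/3; η)` combined with Gauss's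
  `B(η;1/3,1/3) = 3 η^{1/3} ₂F₁(1/3,2/3;4/3;η)`;
* `eulerThird_zero_mul_incBeta13_one` — the constant `N(0) · B(1/3,1/3) = 2√3 π`
  (`B(2/3,2/3) B(1/3,1/3) = 3 Γ(1/3) Γ(2/3) = 3π / sin(π/3)`);
* `carleson_linearity` — the normalised form used for the hitting law:
  `(√3 / 2π) η^{1/3}(1-η)^{1/3} N(η) = B(η;1/3,1/3) / B(1/3,1/3)` on `(0,1)`.

In the proof of the uniform hitting law, `(√3/2π) (1-y)^{1/3} y^{1/3} N(1-y)` is the probability,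
computed with an explicit Schwarz–Christoffel harmonic function, that the reflected Brownian
motion started from the apex exits through the part of the opposite side beyond the point of
parameter `y`; the identity says this is `1 − B(y;1/3,1/3)/B(1/3,1/3)`, i.e. the exit point is
uniform in the boundary parametrisation of the Schwarz–Christoffel map — Carleson's linear form
of Cardy's formula (Smirnov 2001) for this process.

## References

* G. E. Andrews, R. Askey, R. Roy, *Special Functions* (1999), Thm 2.2.1 (Euler's integral),
  Thm 2.2.5 (Euler's transformation), Thm 1.1.4 and (1.2.1) (beta integral, reflection formula).
  [AndrewsAskeyRoy1999]
* S. Smirnov, *Critical percolation in the plane*, C. R. Acad. Sci. 333 (2001) (Carleson's form).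
* J. Dubédat, Ann. IHP 40 (2004), §4 (the same integrals for the reflected Brownian motion).
  [Dubedat2004]
-/

noncomputable section

open Set Filter MeasureTheory intervalIntegral
open scoped Topology Real

namespace Literature.Probability.RandomPlanarGeometry

/-! ### The kernel `s^{-1/3}(1-s)^{-1/3}` -/

/-- The kernel `k(s) = s^{-1/3} (1-s)^{-1/3}` of the beta integral `B(2/3, 2/3)`. [folklore] -/
def thirdKernel (s : ℝ) : ℝ := s ^ (-(1 / 3 : ℝ)) * (1 - s) ^ (-(1 / 3 : ℝ))

/-- `thirdKernel` is the beta kernel `u^{β-1}(1-u)^{-α}` with `β = 2/3`, `α = 1/3`. [folklore] -/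
theorem thirdKernel_eq_betaKernel :
    thirdKernel = fun u : ℝ ↦ u ^ ((2 / 3 : ℝ) - 1) * (1 - u) ^ (-(1 / 3 : ℝ)) := by
  ext u
  rw [thirdKernel, show (2 / 3 : ℝ) - 1 = -(1 / 3) by norm_num]

/-- `k > 0` on `(0, 1)`. [folklore] -/
theorem thirdKernel_pos {s : ℝ} (hs : s ∈ Ioo (0 : ℝ) 1) : 0 < thirdKernel s :=
  mul_pos (Real.rpow_pos_of_pos hs.1 _) (Real.rpow_pos_of_pos (by linarith [hs.2]) _)

/-- `k ≥ 0` on `[0, 1]`. [folklore] -/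
theorem thirdKernel_nonneg {s : ℝ} (hs : s ∈ Icc (0 : ℝ) 1) : 0 ≤ thirdKernel s :=
  mul_nonneg (Real.rpow_nonneg hs.1 _) (Real.rpow_nonneg (by linarith [hs.2]) _)

/-- `k` is continuous on `(0, 1)`. [folklore] -/
theorem continuousOn_thirdKernel : ContinuousOn thirdKernel (Ioo 0 1) := by
  rw [thirdKernel_eq_betaKernel]
  exact continuousOn_betaKernel (1 / 3) (2 / 3)

/-- `k` is integrable on `[0, 1]` (the beta integral `B(2/3,2/3)` converges). [folklore] -/
theorem intervalIntegrable_thirdKernel : IntervalIntegrable thirdKernel volume 0 1 := by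
  rw [thirdKernel_eq_betaKernel]
  exact intervalIntegrable_betaKernel_one (α := 1 / 3) (β := 2 / 3) (by norm_num) (by norm_num)

/-- **Euler's beta integral** `∫₀¹ s^{-1/3}(1-s)^{-1/3} ds = Γ(2/3)² / Γ(4/3)`.
[cite: AndrewsAskeyRoy1999, Thm 1.1.4] -/
theorem integral_thirdKernel :
    ∫ s in (0 : ℝ)..1, thirdKernel s = Real.Gamma (2 / 3) ^ 2 / Real.Gamma (4 / 3) := by
  rw [thirdKernel_eq_betaKernel, integral_betaKernel_eq_Gamma (α := 1 / 3) (β := 2 / 3)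
    (by norm_num) (by norm_num)]
  norm_num [sq]

/-! ### The Euler integral `N(η)` and its derivative -/

/-- **The Euler integral** `N(η) = ∫₀¹ s^{-1/3}(1-s)^{-1/3} (1 - ηs)^{-1} ds`
(`= B(2/3,2/3) ₂F₁(1, 2/3; 4/3; η)`, Andrews–Askey–Roy Thm 2.2.1), for `η < 1`.
[cite: AndrewsAskeyRoy1999, Thm 2.2.1] -/
def eulerThird (η : ℝ) : ℝ := ∫ s in (0 : ℝ)..1, thirdKernel s / (1 - η * s)

/-- The `η`-derivative integrand of `N`: `N'(η) = ∫₀¹ s^{-1/3}(1-s)^{-1/3} s (1 - ηs)^{-2} ds`.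
[cite: AndrewsAskeyRoy1999, Thm 2.2.1] -/
def eulerThirdDeriv (η : ℝ) : ℝ := ∫ s in (0 : ℝ)..1, thirdKernel s * s / (1 - η * s) ^ 2

/-- For `η < 1` and `s ∈ [0, 1]`: `1 - ηs ≥ min 1 (1 - η) > 0`. [folklore] -/
theorem one_sub_mul_ge {η s : ℝ} (hs : s ∈ Icc (0 : ℝ) 1) :
    min 1 (1 - η) ≤ 1 - η * s := by
  rcases le_total 0 η with hη | hη
  · have : η * s ≤ η := by nlinarith [hs.2]
    exact (min_le_right _ _).trans (by linarith)
  · have : η * s ≤ 0 := mul_nonpos_of_nonpos_of_nonneg hη hs.1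
    exact (min_le_left _ _).trans (by linarith)

/-- For `η < 1` and `s ∈ [0, 1]`, `1 - ηs > 0`. [folklore] -/
theorem one_sub_mul_pos {η s : ℝ} (hη : η < 1) (hs : s ∈ Icc (0 : ℝ) 1) : 0 < 1 - η * s :=
  (lt_min one_pos (by linarith)).trans_le (one_sub_mul_ge hs)

/-- Continuity on `[0,1]` of `s ↦ (1 - ηs)⁻¹` for `η < 1`. [folklore] -/
theorem continuousOn_inv_one_sub_mul {η : ℝ} (hη : η < 1) :
    ContinuousOn (fun s : ℝ ↦ (1 - η * s)⁻¹) (Icc 0 1) :=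
  ContinuousOn.inv₀ (by fun_prop) fun s hs ↦ (one_sub_mul_pos hη hs).ne'

/-- Integrability of the integrand of `N(η)` (`η < 1`). [folklore] -/
theorem intervalIntegrable_eulerThird_integrand {η : ℝ} (hη : η < 1) :
    IntervalIntegrable (fun s ↦ thirdKernel s / (1 - η * s)) volume 0 1 := by
  have := intervalIntegrable_thirdKernel.mul_continuousOn
    (by rw [uIcc_of_le zero_le_one]; exact continuousOn_inv_one_sub_mul hη)
  refine this.congr fun s _ ↦ ?_
  rw [div_eq_mul_inv]

/-- Integrability of the integrand of `N'(η)` (`η < 1`). [folklore] -/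
theorem intervalIntegrable_eulerThirdDeriv_integrand {η : ℝ} (hη : η < 1) :
    IntervalIntegrable (fun s ↦ thirdKernel s * s / (1 - η * s) ^ 2) volume 0 1 := by
  have hc : ContinuousOn (fun s : ℝ ↦ s * ((1 - η * s) ^ 2)⁻¹) (uIcc 0 1) := by
    rw [uIcc_of_le zero_le_one]
    refine continuousOn_id.mul (ContinuousOn.inv₀ (by fun_prop) fun s hs ↦ ?_)
    exact pow_ne_zero 2 (one_sub_mul_pos hη hs).ne'
  have := intervalIntegrable_thirdKernel.mul_continuousOn hc
  refine this.congr fun s _ ↦ ?_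
  rw [div_eq_mul_inv, mul_assoc]

/-- **Differentiation under the integral sign**: `N` has derivative `N'` at every `η < 1`.
[cite: AndrewsAskeyRoy1999, Thm 2.2.1] -/
theorem hasDerivAt_eulerThird {η : ℝ} (hη : η < 1) :
    HasDerivAt eulerThird (eulerThirdDeriv η) η := by
  -- a neighbourhood `(η - δ, η + δ)` with `η + δ < 1`, on which `1 - η' s ≥ c₀ > 0`
  obtain ⟨δ, hδ, hδ1⟩ : ∃ δ > 0, η + δ < 1 := ⟨(1 - η) / 2, by linarith, by linarith⟩
  set c₀ : ℝ := min 1 (1 - (η + δ)) with hc₀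
  have hc₀pos : 0 < c₀ := lt_min one_pos (by linarith)
  have hlow : ∀ η' ∈ Ioo (η - δ) (η + δ), ∀ s ∈ Icc (0 : ℝ) 1, c₀ ≤ 1 - η' * s := by
    intro η' hη' s hs
    refine le_trans ?_ (one_sub_mul_ge hs)
    exact min_le_min le_rfl (by linarith [hη'.2])
  -- work with set integrals over `Ioc 0 1`
  have hF : ∀ η', (∫ s in (0 : ℝ)..1, thirdKernel s / (1 - η' * s)) =
      ∫ s in Ioc (0 : ℝ) 1, thirdKernel s / (1 - η' * s) := fun η' ↦ integral_of_le zero_le_one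
  have hF' : eulerThirdDeriv η = ∫ s in Ioc (0 : ℝ) 1, thirdKernel s * s / (1 - η * s) ^ 2 :=
    integral_of_le zero_le_one
  have key := hasDerivAt_integral_of_dominated_loc_of_deriv_le (μ := volume.restrict (Ioc (0 : ℝ) 1))
    (F := fun η' s ↦ thirdKernel s / (1 - η' * s))
    (F' := fun η' s ↦ thirdKernel s * s / (1 - η' * s) ^ 2)
    (x₀ := η) (s := Ioo (η - δ) (η + δ)) (bound := fun s ↦ thirdKernel s * c₀⁻¹ ^ 2)
    (Ioo_mem_nhds (by linarith) (by linarith)) ?_ ?_ ?_ ?_ ?_ ?_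
  · have hfun : eulerThird = fun η' ↦ ∫ s in Ioc (0 : ℝ) 1, thirdKernel s / (1 - η' * s) :=
      funext fun η' ↦ hF η'
    rw [hfun, hF']
    exact key.2
  · -- measurability near `η`
    filter_upwards [Ioo_mem_nhds (show η - δ < η by linarith) (show η < η + δ by linarith)]
      with η' hη'
    have hη'1 : η' < 1 := by linarith [hη'.2]
    exact ((intervalIntegrable_eulerThird_integrand hη'1).1).aestronglyMeasurable
  · exact (intervalIntegrable_eulerThird_integrand hη).1
  · exact ((intervalIntegrable_eulerThirdDeriv_integrand hη).1).aestronglyMeasurable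
  · -- domination of the derivative
    refine (ae_restrict_mem measurableSet_Ioc).mono fun s hs η' hη' ↦ ?_
    have hs' : s ∈ Icc (0 : ℝ) 1 := ⟨hs.1.le, hs.2⟩
    have hk : 0 ≤ thirdKernel s := thirdKernel_nonneg hs'
    have hden : c₀ ≤ 1 - η' * s := hlow η' hη' s hs'
    have hden0 : 0 < 1 - η' * s := hc₀pos.trans_le hden
    rw [Real.norm_eq_abs, abs_of_nonneg (div_nonneg (mul_nonneg hk hs.1.le) (sq_nonneg _))]
    rw [div_eq_mul_inv, mul_assoc]
    refine mul_le_mul_of_nonneg_left ?_ hk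
    rw [← inv_pow]
    calc s * (1 - η' * s)⁻¹ ^ 2 ≤ 1 * (1 - η' * s)⁻¹ ^ 2 :=
          mul_le_mul_of_nonneg_right hs.2 (by positivity)
      _ ≤ c₀⁻¹ ^ 2 := by
          rw [one_mul]
          exact pow_le_pow_left₀ (by positivity) (inv_anti₀ hc₀pos hden) 2
  · -- the bound is integrable
    have := (intervalIntegrable_thirdKernel.mul_const (c₀⁻¹ ^ 2)).1
    exact this
  · -- pointwise differentiability in `η'`
    refine (ae_restrict_mem measurableSet_Ioc).mono fun s hs η' hη' ↦ ?_
    have hs' : s ∈ Icc (0 : ℝ) 1 := ⟨hs.1.le, hs.2⟩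
    have hden0 : (1 - η' * s) ≠ 0 := (hc₀pos.trans_le (hlow η' hη' s hs')).ne'
    have h1 : HasDerivAt (fun x : ℝ ↦ 1 - x * s) (0 - 1 * s) η' :=
      (hasDerivAt_const η' (1 : ℝ)).sub ((hasDerivAt_id η').mul_const s)
    have h2 := (hasDerivAt_const η' (thirdKernel s)).div h1 hden0
    refine h2.congr_deriv ?_
    field_simp
    ring

/-! ### The integration by parts: `∫₀¹ (d/ds)[s^{2/3}(1-s)^{2/3}/(1-ηs)] ds = 0` -/

/-- The auxiliary function `φ(s) = s^{2/3}(1-s)^{2/3}/(1-ηs)`, vanishing at `s = 0, 1`. [folklore] -/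
def eulerPhi (η s : ℝ) : ℝ := s ^ (2 / 3 : ℝ) * (1 - s) ^ (2 / 3 : ℝ) / (1 - η * s)

/-- Its derivative on `(0, 1)`, written over the kernel `k`:
`φ'(s) = k(s) [ (2/3)(1-2s)/(1-ηs) + η s(1-s)/(1-ηs)² ]`. [folklore] -/
def eulerPhiDeriv (η s : ℝ) : ℝ :=
  thirdKernel s * (2 / 3 * (1 - 2 * s) / (1 - η * s) + η * s * (1 - s) / (1 - η * s) ^ 2)

/-- `φ(0) = 0`. [folklore] -/
theorem eulerPhi_zero (η : ℝ) : eulerPhi η 0 = 0 := by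
  simp [eulerPhi, Real.zero_rpow (by norm_num : (2 / 3 : ℝ) ≠ 0)]

/-- `φ(1) = 0`. [folklore] -/
theorem eulerPhi_one (η : ℝ) : eulerPhi η 1 = 0 := by
  simp [eulerPhi, Real.zero_rpow (by norm_num : (2 / 3 : ℝ) ≠ 0)]

/-- `φ` is continuous on `[0, 1]` (`η < 1`). [folklore] -/
theorem continuousOn_eulerPhi {η : ℝ} (hη : η < 1) : ContinuousOn (eulerPhi η) (Icc 0 1) := by
  refine ContinuousOn.div ?_ (by fun_prop) fun s hs ↦ (one_sub_mul_pos hη hs).ne'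
  refine ContinuousOn.mul ?_ ?_
  · exact ContinuousOn.rpow_const continuousOn_id fun _ _ ↦ Or.inr (by norm_num)
  · exact ContinuousOn.rpow_const (by fun_prop) fun _ _ ↦ Or.inr (by norm_num)

/-- `φ' = eulerPhiDeriv` on `(0, 1)` (`η < 1`). [folklore] -/
theorem hasDerivAt_eulerPhi {η : ℝ} (hη : η < 1) {s : ℝ} (hs : s ∈ Ioo (0 : ℝ) 1) :
    HasDerivAt (eulerPhi η) (eulerPhiDeriv η s) s := by
  have hs0 : 0 < s := hs.1
  have hs1 : 0 < 1 - s := by linarith [hs.2]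
  have hden : 1 - η * s ≠ 0 := (one_sub_mul_pos hη ⟨hs.1.le, hs.2.le⟩).ne'
  -- derivatives of the three factors
  have hA : HasDerivAt (fun x : ℝ ↦ x ^ (2 / 3 : ℝ)) (2 / 3 * s ^ (-(1 / 3) : ℝ)) s := by
    have := (hasDerivAt_id s).rpow_const (p := (2 / 3 : ℝ)) (Or.inl hs0.ne')
    simp only [id_eq, one_mul] at this
    rw [show (2 / 3 : ℝ) - 1 = -(1 / 3) by norm_num] at this
    exact this
  have hB : HasDerivAt (fun x : ℝ ↦ (1 - x) ^ (2 / 3 : ℝ)) (-(2 / 3 * (1 - s) ^ (-(1 / 3) : ℝ))) s := by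
    have h1 : HasDerivAt (fun x : ℝ ↦ 1 - x) (0 - 1) s :=
      (hasDerivAt_const s (1 : ℝ)).sub (hasDerivAt_id s)
    have h2 := h1.rpow_const (p := (2 / 3 : ℝ)) (Or.inl hs1.ne')
    rw [show (2 / 3 : ℝ) - 1 = -(1 / 3) by norm_num] at h2
    refine h2.congr_deriv ?_
    ring
  have hC : HasDerivAt (fun x : ℝ ↦ 1 - η * x) (-η) s := by
    simpa using ((hasDerivAt_id s).const_mul η).const_sub 1
  have hprod := (hA.fun_mul hB).fun_div hC hden
  -- rewrite `x^{2/3} = x^{-1/3} · x`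
  have eA : s ^ (2 / 3 : ℝ) = s ^ (-(1 / 3) : ℝ) * s := by
    rw [show (2 / 3 : ℝ) = -(1 / 3) + 1 by norm_num, Real.rpow_add hs0, Real.rpow_one]
  have eB : (1 - s) ^ (2 / 3 : ℝ) = (1 - s) ^ (-(1 / 3) : ℝ) * (1 - s) := by
    rw [show (2 / 3 : ℝ) = -(1 / 3) + 1 by norm_num, Real.rpow_add hs1, Real.rpow_one]
  have hfun : eulerPhi η = fun x : ℝ ↦ x ^ (2 / 3 : ℝ) * (1 - x) ^ (2 / 3 : ℝ) / (1 - η * x) := by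
    ext x
    simp [eulerPhi]
  rw [hfun]
  refine hprod.congr_deriv ?_
  have hden2 : (1 - η * s) ^ 2 ≠ 0 := pow_ne_zero 2 hden
  rw [eA, eB, eulerPhiDeriv, thirdKernel]
  field_simp
  ring

/-- Continuity on `[0,1]` of the bracket in `φ'` (`η < 1`). [folklore] -/
theorem continuousOn_eulerPhiDeriv_bracket {η : ℝ} (hη : η < 1) :
    ContinuousOn (fun s : ℝ ↦ 2 / 3 * (1 - 2 * s) / (1 - η * s) +
      η * s * (1 - s) / (1 - η * s) ^ 2) (Icc 0 1) := by
  refine ContinuousOn.add ?_ ?_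
  · exact ContinuousOn.div (by fun_prop) (by fun_prop) fun s hs ↦ (one_sub_mul_pos hη hs).ne'
  · exact ContinuousOn.div (by fun_prop) (by fun_prop)
      fun s hs ↦ pow_ne_zero 2 (one_sub_mul_pos hη hs).ne'

/-- `φ'` is integrable on `[0, 1]` (`η < 1`). [folklore] -/
theorem intervalIntegrable_eulerPhiDeriv {η : ℝ} (hη : η < 1) :
    IntervalIntegrable (eulerPhiDeriv η) volume 0 1 :=
  intervalIntegrable_thirdKernel.mul_continuousOn
    (by rw [uIcc_of_le zero_le_one]; exact continuousOn_eulerPhiDeriv_bracket hη)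

/-- **`∫₀¹ φ' = φ(1) - φ(0) = 0`** (fundamental theorem of calculus for a function continuous on
`[0,1]` and differentiable on `(0,1)` with integrable derivative). [folklore] -/
theorem integral_eulerPhiDeriv {η : ℝ} (hη : η < 1) : ∫ s in (0 : ℝ)..1, eulerPhiDeriv η s = 0 := by
  rw [integral_eq_sub_of_hasDerivAt_of_le zero_le_one (continuousOn_eulerPhi hη)
    (fun s hs ↦ hasDerivAt_eulerPhi hη hs) (intervalIntegrable_eulerPhiDeriv hη),
    eulerPhi_one, eulerPhi_zero, sub_zero]

/-! ### The first-order equation for `N` -/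

/-- Pointwise identity of integrands on `(0,1)`:
`η(1-η) · k s/(1-ηs)² + ((1-2η)/3) · k/(1-ηs) − k/3 = −η φ'(s)`. [folklore] -/
theorem eulerThird_integrand_identity {η s : ℝ} (hη : η < 1) (hs : s ∈ Ioo (0 : ℝ) 1) :
    η * (1 - η) * (thirdKernel s * s / (1 - η * s) ^ 2) +
        (1 - 2 * η) / 3 * (thirdKernel s / (1 - η * s)) - thirdKernel s / 3 =
      -η * eulerPhiDeriv η s := by
  have hden : 1 - η * s ≠ 0 := (one_sub_mul_pos hη ⟨hs.1.le, hs.2.le⟩).ne'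
  rw [eulerPhiDeriv]
  field_simp
  ring

/-- **The first-order (Euler) equation** `η(1-η) N'(η) + ((1-2η)/3) N(η) = N(0)/3` for `η < 1`,
equivalently `(d/dη)[η^{1/3}(1-η)^{1/3} N(η)] = (N(0)/3) η^{-2/3}(1-η)^{-2/3}`; it is the
`a = 1` (first-order) case of the hypergeometric equation for `₂F₁(1, 2/3; 4/3; ·)`.
[cite: AndrewsAskeyRoy1999, Thm 2.2.1] -/
theorem eulerThird_ode {η : ℝ} (hη : η < 1) :
    η * (1 - η) * eulerThirdDeriv η + (1 - 2 * η) / 3 * eulerThird η =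
      (∫ s in (0 : ℝ)..1, thirdKernel s) / 3 := by
  have h1 := intervalIntegrable_eulerThirdDeriv_integrand hη
  have h2 := intervalIntegrable_eulerThird_integrand hη
  have h3 := intervalIntegrable_thirdKernel
  have hcomb : ∫ s in (0 : ℝ)..1, (η * (1 - η) * (thirdKernel s * s / (1 - η * s) ^ 2) +
      (1 - 2 * η) / 3 * (thirdKernel s / (1 - η * s)) - thirdKernel s / 3) =
      ∫ s in (0 : ℝ)..1, -η * eulerPhiDeriv η s := by
    refine integral_congr_ae ?_
    have : ∀ᵐ s : ℝ, s ≠ 1 := by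
      simp [ae_iff]
    filter_upwards [this] with s hs1 hs
    rw [uIoc_of_le zero_le_one] at hs
    exact eulerThird_integrand_identity hη ⟨hs.1, lt_of_le_of_ne hs.2 hs1⟩
  have hZ : (∫ s in (0 : ℝ)..1, -η * eulerPhiDeriv η s) = 0 := by
    rw [intervalIntegral.integral_const_mul, integral_eulerPhiDeriv hη, mul_zero]
  have hI : (∫ s in (0 : ℝ)..1, (η * (1 - η) * (thirdKernel s * s / (1 - η * s) ^ 2) +
      (1 - 2 * η) / 3 * (thirdKernel s / (1 - η * s)) - thirdKernel s / 3)) =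
      η * (1 - η) * eulerThirdDeriv η + (1 - 2 * η) / 3 * eulerThird η -
        (∫ s in (0 : ℝ)..1, thirdKernel s) / 3 := by
    rw [intervalIntegral.integral_sub ((h1.const_mul _).add (h2.const_mul _)) (h3.div_const 3),
      intervalIntegral.integral_add (h1.const_mul _) (h2.const_mul _),
      intervalIntegral.integral_const_mul, intervalIntegral.integral_const_mul,
      intervalIntegral.integral_div, eulerThirdDeriv, eulerThird]
  linarith [hcomb, hI, hZ]

/-- `N(0) = ∫₀¹ k = B(2/3, 2/3)`. [folklore] -/
theorem eulerThird_zero : eulerThird 0 = ∫ s in (0 : ℝ)..1, thirdKernel s := by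
  simp [eulerThird]

/-! ### Integrated form: `η^{1/3}(1-η)^{1/3} N(η) = (N(0)/3) B(η; 1/3, 1/3)` -/

/-- `B(·;1/3,1/3)` has derivative `η^{-2/3}(1-η)^{-2/3}` on `(0,1)`. [folklore] -/
theorem hasDerivAt_incBeta13 {η : ℝ} (hη : η ∈ Ioo (0 : ℝ) 1) :
    HasDerivAt incBeta13 (η ^ (-(2 / 3 : ℝ)) * (1 - η) ^ (-(2 / 3 : ℝ))) η := by
  have hcont : ContinuousOn betaKernel13 (Ioo 0 1) := by
    intro u hu
    refine ContinuousAt.continuousWithinAt ?_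
    unfold betaKernel13
    exact ContinuousAt.rpow_const (by fun_prop) (Or.inl (mul_pos hu.1 (by linarith [hu.2])).ne')
  have h := intervalIntegral.integral_hasDerivAt_right
    (intervalIntegrable_betaKernel13_of_mem ⟨le_rfl, zero_le_one⟩ ⟨hη.1.le, hη.2.le⟩)
    (hcont.stronglyMeasurableAtFilter isOpen_Ioo _ hη) (hcont.continuousAt (isOpen_Ioo.mem_nhds hη))
  have hval : betaKernel13 η = η ^ (-(2 / 3 : ℝ)) * (1 - η) ^ (-(2 / 3 : ℝ)) := by
    rw [betaKernel13, Real.mul_rpow hη.1.le (by linarith [hη.2])]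
  rw [← hval]
  exact h

/-- The function `W(η) = η^{1/3}(1-η)^{1/3} N(η)` has derivative
`(N(0)/3) η^{-2/3}(1-η)^{-2/3}` on `(0, 1)`. [folklore] -/
theorem hasDerivAt_rpow_mul_eulerThird {η : ℝ} (hη : η ∈ Ioo (0 : ℝ) 1) :
    HasDerivAt (fun x : ℝ ↦ x ^ (1 / 3 : ℝ) * (1 - x) ^ (1 / 3 : ℝ) * eulerThird x)
      ((∫ s in (0 : ℝ)..1, thirdKernel s) / 3 * (η ^ (-(2 / 3 : ℝ)) * (1 - η) ^ (-(2 / 3 : ℝ))))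
      η := by
  have h0 : 0 < η := hη.1
  have h1 : 0 < 1 - η := by linarith [hη.2]
  have hA : HasDerivAt (fun x : ℝ ↦ x ^ (1 / 3 : ℝ)) (1 / 3 * η ^ (-(2 / 3) : ℝ)) η := by
    have := (hasDerivAt_id η).rpow_const (p := (1 / 3 : ℝ)) (Or.inl h0.ne')
    simp only [id_eq, one_mul] at this
    rw [show (1 / 3 : ℝ) - 1 = -(2 / 3) by norm_num] at this
    exact this
  have hB : HasDerivAt (fun x : ℝ ↦ (1 - x) ^ (1 / 3 : ℝ)) (-(1 / 3 * (1 - η) ^ (-(2 / 3) : ℝ))) η := by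
    have h1' : HasDerivAt (fun x : ℝ ↦ 1 - x) (0 - 1) η :=
      (hasDerivAt_const η (1 : ℝ)).sub (hasDerivAt_id η)
    have h2 := h1'.rpow_const (p := (1 / 3 : ℝ)) (Or.inl h1.ne')
    rw [show (1 / 3 : ℝ) - 1 = -(2 / 3) by norm_num] at h2
    refine h2.congr_deriv ?_
    ring
  have hN := hasDerivAt_eulerThird hη.2
  have hprod := (hA.fun_mul hB).fun_mul hN
  refine hprod.congr_deriv ?_
  -- use the first-order equation and `x^{1/3} = x^{-2/3} x`
  have hode := eulerThird_ode hη.2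
  have eA : η ^ (1 / 3 : ℝ) = η ^ (-(2 / 3) : ℝ) * η := by
    rw [show (1 / 3 : ℝ) = -(2 / 3) + 1 by norm_num, Real.rpow_add h0, Real.rpow_one]
  have eB : (1 - η) ^ (1 / 3 : ℝ) = (1 - η) ^ (-(2 / 3) : ℝ) * (1 - η) := by
    rw [show (1 / 3 : ℝ) = -(2 / 3) + 1 by norm_num, Real.rpow_add h1, Real.rpow_one]
  rw [eA, eB]
  set K := ∫ s in (0 : ℝ)..1, thirdKernel s
  have hK : K / 3 = η * (1 - η) * eulerThirdDeriv η + (1 - 2 * η) / 3 * eulerThird η := hode.symm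
  rw [hK]
  ring

/-- `N` is continuous on `(-∞, 1)`. [folklore] -/
theorem continuousAt_eulerThird {η : ℝ} (hη : η < 1) : ContinuousAt eulerThird η :=
  (hasDerivAt_eulerThird hη).continuousAt

/-- **Euler's transformation, integrated form**: for `η ∈ (0, 1)`,
`η^{1/3} (1-η)^{1/3} N(η) = (N(0)/3) · B(η; 1/3, 1/3)`; equivalently
`B(2/3,2/3) ₂F₁(1, 2/3; 4/3; η) = (1-η)^{-1/3} · (B(2/3,2/3)/3) · 3 ₂F₁(1/3, 2/3; 4/3; η)`
(Andrews–Askey–Roy Thm 2.2.5 with `(a, b, c) = (1, 2/3, 4/3)`). Both sides vanish at `0⁺` and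
have the same derivative on `(0, 1)`. [cite: AndrewsAskeyRoy1999, Thm 2.2.5] -/
theorem rpow_mul_eulerThird_eq {η : ℝ} (hη : η ∈ Ioo (0 : ℝ) 1) :
    η ^ (1 / 3 : ℝ) * (1 - η) ^ (1 / 3 : ℝ) * eulerThird η =
      (∫ s in (0 : ℝ)..1, thirdKernel s) / 3 * incBeta13 η := by
  set K := ∫ s in (0 : ℝ)..1, thirdKernel s with hK
  set W : ℝ → ℝ := fun x ↦ x ^ (1 / 3 : ℝ) * (1 - x) ^ (1 / 3 : ℝ) * eulerThird x with hW
  set V : ℝ → ℝ := fun x ↦ K / 3 * incBeta13 x with hV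
  -- same derivative on `(0, 1)`
  have hWd : ∀ x ∈ Ioo (0 : ℝ) 1, HasDerivAt W
      (K / 3 * (x ^ (-(2 / 3 : ℝ)) * (1 - x) ^ (-(2 / 3 : ℝ)))) x :=
    fun x hx ↦ hasDerivAt_rpow_mul_eulerThird hx
  have hVd : ∀ x ∈ Ioo (0 : ℝ) 1, HasDerivAt V
      (K / 3 * (x ^ (-(2 / 3 : ℝ)) * (1 - x) ^ (-(2 / 3 : ℝ)))) x :=
    fun x hx ↦ (hasDerivAt_incBeta13 hx).const_mul (K / 3)
  -- hence `W - V` is constant on `(0, 1)`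
  obtain ⟨c, hc⟩ : ∃ c, ∀ x ∈ Ioo (0 : ℝ) 1, (W - V) x = c := by
    refine isOpen_Ioo.exists_is_const_of_deriv_eq_zero isPreconnected_Ioo ?_ ?_
    · intro x hx
      exact ((hWd x hx).sub (hVd x hx)).differentiableAt.differentiableWithinAt
    · intro x hx
      have := ((hWd x hx).sub (hVd x hx)).deriv
      rw [sub_self] at this
      simpa using this
  -- and the constant is `0`: both tend to `0` at `0⁺`
  have hlimW : Tendsto W (𝓝[>] 0) (𝓝 0) := by
    have h1 : Tendsto (fun x : ℝ ↦ x ^ (1 / 3 : ℝ)) (𝓝[>] 0) (𝓝 0) := by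
      have := (Real.continuousAt_rpow_const 0 (1 / 3 : ℝ) (Or.inr (by norm_num))).tendsto
      rw [Real.zero_rpow (by norm_num)] at this
      exact this.mono_left nhdsWithin_le_nhds
    have h2 : Tendsto (fun x : ℝ ↦ (1 - x) ^ (1 / 3 : ℝ)) (𝓝[>] 0) (𝓝 1) := by
      have hc : ContinuousAt (fun x : ℝ ↦ (1 - x) ^ (1 / 3 : ℝ)) 0 :=
        ContinuousAt.rpow_const (by fun_prop) (Or.inr (by norm_num))
      have := hc.tendsto
      simp only [sub_zero, Real.one_rpow] at this
      exact this.mono_left nhdsWithin_le_nhds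
    have h3 : Tendsto eulerThird (𝓝[>] 0) (𝓝 (eulerThird 0)) :=
      (continuousAt_eulerThird one_pos).tendsto.mono_left nhdsWithin_le_nhds
    have := (h1.mul h2).mul h3
    simpa [hW] using this
  have hlimV : Tendsto V (𝓝[>] 0) (𝓝 0) := by
    have hcont : ContinuousWithinAt incBeta13 (Icc 0 1) 0 :=
      incBeta13_continuousOn 0 ⟨le_rfl, zero_le_one⟩
    have h1 : Tendsto incBeta13 (𝓝[>] 0) (𝓝 0) := by
      have := hcont.tendsto
      rw [incBeta13_zero] at this
      rw [← nhdsWithin_Ioo_eq_nhdsGT one_pos]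
      exact this.mono_left (nhdsWithin_mono 0 Ioo_subset_Icc_self)
    have := h1.const_mul (K / 3)
    simpa [hV] using this
  have hc0 : c = 0 := by
    have hlim : Tendsto (W - V) (𝓝[>] 0) (𝓝 (0 - 0)) := hlimW.sub hlimV
    have hev : ∀ᶠ x in 𝓝[>] (0 : ℝ), (W - V) x = c := by
      filter_upwards [Ioo_mem_nhdsGT one_pos] with x hx using hc x hx
    have hlim' : Tendsto (W - V) (𝓝[>] 0) (𝓝 c) := (tendsto_congr' hev).2 tendsto_const_nhds
    have := tendsto_nhds_unique hlim' hlim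
    simpa using this
  have := hc η hη
  rw [hc0, Pi.sub_apply, sub_eq_zero] at this
  simpa [hW, hV] using this

/-! ### The constants -/

/-- `N(0) · B(1/3, 1/3) = 2√3 π`: indeed `N(0) = Γ(2/3)²/Γ(4/3) = 3Γ(2/3)²/Γ(1/3)` and
`B(1/3,1/3) = Γ(1/3)²/Γ(2/3)`, so the product is `3 Γ(1/3) Γ(2/3) = 3π / sin(π/3)` by the
reflection formula. [cite: AndrewsAskeyRoy1999, Thm 1.1.4] -/
theorem integral_thirdKernel_mul_incBeta13_one :
    (∫ s in (0 : ℝ)..1, thirdKernel s) * incBeta13 1 = 2 * Real.sqrt 3 * π := by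
  rw [integral_thirdKernel, incBeta13_one_eq_Gamma]
  have h43 : Real.Gamma (4 / 3) = 1 / 3 * Real.Gamma (1 / 3) := by
    rw [show (4 / 3 : ℝ) = 1 / 3 + 1 by norm_num, Real.Gamma_add_one (by norm_num)]
  have hrefl : Real.Gamma (1 / 3) * Real.Gamma (2 / 3) = π / Real.sin (π / 3) := by
    rw [show (2 / 3 : ℝ) = 1 - 1 / 3 by norm_num, Real.Gamma_mul_Gamma_one_sub]
    congr 1
    ring_nf
  rw [Real.sin_pi_div_three] at hrefl
  have hG1 : Real.Gamma (1 / 3) ≠ 0 := (Real.Gamma_pos_of_pos (by norm_num)).ne'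
  have hG2 : Real.Gamma (2 / 3) ≠ 0 := (Real.Gamma_pos_of_pos (by norm_num)).ne'
  have h3 : Real.sqrt 3 ≠ 0 := by positivity
  have hmul : Real.sqrt 3 * Real.sqrt 3 = 3 := Real.mul_self_sqrt (by norm_num)
  rw [h43]
  calc Real.Gamma (2 / 3) ^ 2 / (1 / 3 * Real.Gamma (1 / 3)) *
        (Real.Gamma (1 / 3) ^ 2 / Real.Gamma (2 / 3))
        = 3 * (Real.Gamma (1 / 3) * Real.Gamma (2 / 3)) := by field_simp
    _ = 3 * (π / (Real.sqrt 3 / 2)) := by rw [hrefl]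
    _ = 2 * Real.sqrt 3 * π := by
        field_simp
        linear_combination (-1 : ℝ) * hmul

/-- **Carleson's linearity** (normalised Euler transformation): for `η ∈ (0, 1)`,
`(√3 / (2π)) · η^{1/3}(1-η)^{1/3} N(η) = B(η; 1/3, 1/3) / B(1/3, 1/3)`.
[cite: AndrewsAskeyRoy1999, Thm 2.2.5] -/
theorem carleson_linearity {η : ℝ} (hη : η ∈ Ioo (0 : ℝ) 1) :
    Real.sqrt 3 / (2 * π) * (η ^ (1 / 3 : ℝ) * (1 - η) ^ (1 / 3 : ℝ) * eulerThird η) =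
      incBeta13 η / incBeta13 1 := by
  rw [rpow_mul_eulerThird_eq hη]
  have hB : incBeta13 1 ≠ 0 := incBeta13_one_pos.ne'
  have hπ : π ≠ 0 := Real.pi_pos.ne'
  have hprod := integral_thirdKernel_mul_incBeta13_one
  set K := ∫ s in (0 : ℝ)..1, thirdKernel s
  field_simp
  have : K = 2 * Real.sqrt 3 * π / incBeta13 1 := by
    rw [eq_div_iff hB, hprod]
  rw [this]
  field_simp
  have hs3 : Real.sqrt 3 ^ 2 = 3 := Real.sq_sqrt (by norm_num)
  rw [hs3]
  ring

/-! ### The half-line form `∫₀^∞ u^{-1/3}(1+u)^{-1/3}(u+y)^{-1} du = N(1-y)` -/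

/-- The substitution map `t ↦ (1-t)/t` sends `(0,1)` onto `(0,∞)`. [folklore] -/
theorem image_sub_div_Ioo : (fun t : ℝ ↦ (1 - t) / t) '' Ioo 0 1 = Ioi 0 := by
  ext u
  constructor
  · rintro ⟨t, ht, rfl⟩
    exact div_pos (by linarith [ht.2]) ht.1
  · intro hu
    have hu' : 0 < u := hu
    refine ⟨1 / (1 + u), ⟨by positivity, ?_⟩, ?_⟩
    · rw [div_lt_one (by positivity)]
      linarith
    · have : (1 + u) ≠ 0 := by positivity
      field_simp
      ring

/-- **Half-line form of the Euler integral**: for `y ∈ (0,1)`,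
`∫₀^∞ u^{-1/3} (1+u)^{-1/3} (u+y)^{-1} du = N(1-y)` (substitute `u = (1-t)/t`).
[cite: AndrewsAskeyRoy1999, Thm 2.2.1] -/
theorem integral_Ioi_thirdKernel_form {y : ℝ} (hy : y ∈ Ioo (0 : ℝ) 1) :
    ∫ u in Ioi (0 : ℝ), u ^ (-(1 / 3 : ℝ)) * (1 + u) ^ (-(1 / 3 : ℝ)) / (u + y) =
      eulerThird (1 - y) := by
  set f : ℝ → ℝ := fun t ↦ (1 - t) / t with hf
  set g : ℝ → ℝ := fun u ↦ u ^ (-(1 / 3 : ℝ)) * (1 + u) ^ (-(1 / 3 : ℝ)) / (u + y) with hg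
  have hderiv : ∀ t ∈ Ioo (0 : ℝ) 1, HasDerivWithinAt f (-1 / t ^ 2) (Ioo 0 1) t := by
    intro t ht
    have ht0 : t ≠ 0 := ht.1.ne'
    have h1 : HasDerivAt (fun x : ℝ ↦ 1 - x) (0 - 1) t :=
      (hasDerivAt_const t (1 : ℝ)).sub (hasDerivAt_id t)
    have h2 := h1.div (hasDerivAt_id t) ht0
    refine (h2.congr_deriv ?_).hasDerivWithinAt
    simp only [id_eq]
    field_simp
    ring
  have hinj : InjOn f (Ioo 0 1) := by
    intro t ht t' ht' h
    simp only [hf] at h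
    have ht0 : t ≠ 0 := ht.1.ne'
    have ht0' : t' ≠ 0 := ht'.1.ne'
    field_simp at h
    linarith
  have himg : f '' Ioo 0 1 = Ioi 0 := image_sub_div_Ioo
  rw [← himg, integral_image_eq_integral_abs_deriv_smul measurableSet_Ioo hderiv hinj g]
  -- identify the transformed integrand with that of `N(1-y)`
  have hpt : ∀ t ∈ Ioo (0 : ℝ) 1, |(-1 / t ^ 2)| • g (f t) = thirdKernel t / (1 - (1 - y) * t) := by
    intro t ht
    have ht0 : 0 < t := ht.1
    have ht1 : 0 < 1 - t := by linarith [ht.2]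
    have hden : 0 < 1 - (1 - y) * t := by nlinarith [hy.1, hy.2, ht.2]
    set a : ℝ := t ^ (1 / 3 : ℝ) with ha
    set b : ℝ := (1 - t) ^ (-(1 / 3 : ℝ)) with hb
    have ha0 : 0 < a := Real.rpow_pos_of_pos ht0 _
    have hb0 : 0 < b := Real.rpow_pos_of_pos ht1 _
    have ha3 : a ^ 3 = t := by
      rw [ha, ← Real.rpow_natCast, ← Real.rpow_mul ht0.le]
      norm_num
    have htneg : t ^ (-(1 / 3 : ℝ)) = a⁻¹ := by
      rw [ha, Real.rpow_neg ht0.le]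
    have hu1 : f t ^ (-(1 / 3 : ℝ)) = b * a := by
      simp only [hf]
      rw [Real.div_rpow ht1.le ht0.le, htneg, ← hb]
      field_simp
    have hu2 : (1 + f t) ^ (-(1 / 3 : ℝ)) = a := by
      have : 1 + f t = t⁻¹ := by
        simp only [hf]
        field_simp
        ring
      rw [this, Real.inv_rpow ht0.le, htneg, inv_inv]
    have hu3 : f t + y = (1 - (1 - y) * t) / t := by
      simp only [hf]
      field_simp
      ring
    have habs : |(-1 / t ^ 2)| = 1 / t ^ 2 := by
      rw [abs_div, abs_neg, abs_one, abs_of_pos (by positivity)]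
    have hden' : (1 - t + t * y) ≠ 0 := (by linarith : (0 : ℝ) < 1 - t + t * y).ne'
    rw [habs, smul_eq_mul, hg]
    simp only
    rw [hu1, hu2, hu3, thirdKernel, htneg, ← hb]
    field_simp
    -- remaining polynomial identity, using `a³ = t`
    linear_combination (1 - t + t * y)⁻¹ * ha3
  rw [setIntegral_congr_fun measurableSet_Ioo hpt, ← integral_Ioc_eq_integral_Ioo,
    ← integral_of_le zero_le_one, eulerThird]

/-- **The hitting-law form of the identity**: for `y ∈ (0, 1)`,
`(√3/(2π)) y^{1/3}(1-y)^{1/3} ∫₀^∞ u^{-1/3}(1+u)^{-1/3}(u+y)^{-1} du = 1 − B(y;1/3,1/3)/B(1/3,1/3)`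
— the probability that the obliquely reflected Brownian motion from the apex exits beyond the
point of Schwarz–Christoffel parameter `y` is the uniform one. [cite: Dubedat2004, §1 and §4] -/
theorem carleson_linearity_Ioi {y : ℝ} (hy : y ∈ Ioo (0 : ℝ) 1) :
    Real.sqrt 3 / (2 * π) * (y ^ (1 / 3 : ℝ) * (1 - y) ^ (1 / 3 : ℝ) *
        ∫ u in Ioi (0 : ℝ), u ^ (-(1 / 3 : ℝ)) * (1 + u) ^ (-(1 / 3 : ℝ)) / (u + y)) =
      1 - incBeta13 y / incBeta13 1 := by
  rw [integral_Ioi_thirdKernel_form hy]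
  have hy' : 1 - y ∈ Ioo (0 : ℝ) 1 := ⟨by linarith [hy.2], by linarith [hy.1]⟩
  have h := carleson_linearity hy'
  rw [sub_sub_cancel] at h
  have hB : incBeta13 1 ≠ 0 := incBeta13_one_pos.ne'
  rw [show y ^ (1 / 3 : ℝ) * (1 - y) ^ (1 / 3 : ℝ) * eulerThird (1 - y) =
      (1 - y) ^ (1 / 3 : ℝ) * y ^ (1 / 3 : ℝ) * eulerThird (1 - y) by ring, h,
    incBeta13_one_sub ⟨hy.1.le, hy.2.le⟩]
  field_simp

end Literature.Probability.RandomPlanarGeometry
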